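import Summits.QuantumFields.GaugeBoot.Certificates.SparseReducedWindow
import Summits.QuantumFields.GaugeBoot.Certificates.KZL2rpLIMb9o5W22UpDA
import Summits.QuantumFields.GaugeBoot.Certificates.KZL2rpLIMb9o5W22UpDB
import HarnessLib

/-!
# Kernel replay of the certsdp certificate `kzL2rpLIM_D4_b9o5_W2x2_upper` — part G: factor-row assembly and objective (gb_lean_emit_win 0.11.0-lim)

HONEST FRAMING (cell `pub-gaugeboot`): certified bounds on lattice expectations at stated coupling,
gauge group, dimension and torus size; NOT a mass gap, NOT a continuum limit, NOT a string tension;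
NOT Yang–Mills-summit-bearing (barriers `FixedCouplingUltralocality`, `PerturbativeInvisibility`).

Certificate sha256 `cf2188a1f2e9269c4e4391d53ef4c914df63111b1d8d177bd0d5602abe73d9c6` (problem `kzL2_D4_b9o5_max_rp_hkhd_LIM_G2-W2x2-upper`, sha256 `860c9244a649ae9ddf8180aae29cb943d997bebe071769a21309e77d3712cef7`): `GB` = all factor rows (data parts
`Certificates/KZL2rpLIMb9o5W22UpD….lean` concatenated), the INTEGER objective row `cZ`, the certified bound `lowerQ`, and the kernel check
`gb_len` (factor rows fit the padded dimension 48). Windows: `Certificates/KZL2rpLIMb9o5W22UpA….lean`; assembly + theorems: `Certificates/KZL2rpLIMb9o5W22Up.lean`.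
Data/plumbing only; nothing is claimed about lattice gauge theory in this file.
-/

namespace Summit.QuantumFields.GaugeBoot.Certificates.KZL2rpLIMb9o5W22Up

noncomputable section

open Summit.QuantumFields.GaugeBoot.Certificates.Sparse

/-- All factor rows (concatenation of the data parts' block lists). -/
def GB : List (List (List ℤ)) := GBa ++ GBb

/-- Objective as a sparse INTEGER row: (-1)·y_13. -/
def cZ : List (ℕ × ℤ) := [(13, Int.negSucc 0)]

/-- The certified lower bound on the objective (exact): `-43488604944922462309545271913/102003116029984336615833600000` (≈ -0.4263458474361). -/
def lowerQ : ℚ := -43488604944922462309545271913/102003116029984336615833600000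

set_option maxHeartbeats 0 in
/-- Kernel check: every factor row of every block has length `≤ 48`. -/
theorem gb_len : lenCheckAll KZL2rpLIMb9o5W22Up.GB 48 75 = true := by
  decide +kernel

end

end Summit.QuantumFields.GaugeBoot.Certificates.KZL2rpLIMb9o5W22Up
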